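import Summits.QuantumFields.YangMills.Theorems.AllWindowsColdBoxBoxHighLineGaussianPolyIntegrable
import Summits.QuantumFields.YangMills.Theorems.AllWindowsColdBoxBoxHighLinePlaquetteObsL4
import Summits.QuantumFields.YangMills.Theorems.AllWindowsColdBoxBoxHighLineTripleFormExpansion
import Summits.QuantumFields.YangMills.Theorems.AllWindowsColdBoxBoxHighLineVarianceBounded

/-!
# T-S5.12d, part 1 — Gaussian moments of the four edge variables of a plaquette: `E₀[S²] ≲ β⁻²`, `E₀[S⁴] ≲ β⁻⁴`, `S = Σ_i ‖v_i‖²`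

Support file for T-S5.12d `PlaquetteObsL2` (✓`…Step2Wick`, planner ym-idea-2 g18; STEP 2 of the XL stub S5, LINE-19 ⟨stmt-QuantumFields-24004⟩/⟨24335⟩).
The pointwise dominators of the odd part `c_p^{odd}` and of the even remainder `c_p − |ℓ_p|² − c_p^{odd}` of the plaquette cost in the chart are powers of
`S(a) = Σ_{i<4} ‖plaqVar H x μ ν a i‖²` (sum of the squared norms of the four edge variables); this file controls their Gaussian sizes under
`gaussAvg β H` (✓`gaussWeight = e^{−β·boxQuadForm}`):

* `freeVec_apply_eq_leg` — a chart edge variable is a LEG `u_{ed} ⬝ a^c` with the indicator `u_{ed}(e) = [e = ed]` (✓`EdgeChartGaussian.freeVec_apply_eq_sum`),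
  `indicator_kernel_nonneg/le` — `0 ≤ u_{ed}·hodgeQ⁻¹·u_{ed} ≤ 1036` (a diagonal entry of `hodgeQ⁻¹`, ✓S3a `landauVarianceBounded`, or `0`);
* `gaussAvg_colourSq`, `gaussAvg_colourSq_sq` — the exact one-leg Gaussian sizes `E₀[Σ_c(u⬝a^c)²] = (3/2)β⁻¹K_u`, `E₀[(Σ_c(u⬝a^c)²)²] = (15/4)β⁻²K_u²`
  for ANY `u` (LEAD's ✓`integral_colourSumSq_mul_exp` / ✓`cov_colourSumSq`, as in ✓`PlaqObsL4.gaussAvg_linCurvSq_sq`);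
* `integrable_polyFlat_mul_gaussWeight` — integrability in the `a`-letters of observables that are polynomial in the flat chart variable
  (✓`Hypercontractivity.integrable_mul_exp_quadForm_of_polyDeg` + ✓`volume_preserving_flatten`), and `gaussAvg_mono` / `gaussAvg_add` / `gaussAvg_smul`;
* ★ `gaussAvg_edgeSq_sq_le` — `E₀[S²] ≤ 60·1036²/β²`; ★ `gaussAvg_edgeSq_pow_four_le` — `E₀[S⁴] ≤ 81·E₀[S²]²` (✓hypercontractivity, `S` is polyDeg 2)
  `≤ 81·60²·1036⁴/β⁴`.

Tree + Mathlib only; no definitions.  HONEST LABEL: support lemmas for one S brick of STEP 2 of the XL stub S5 of a critic-PASSed DRAFT line; 12d, S5, U5,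
⟨stmt-QuantumFields-24004⟩ ⟨24335⟩ ⟨24336⟩ remain OPEN; route AllWindowsColdBox is DRAFT; **the Yang–Mills mass gap is NOT proved by this file; no summit
is proved by a line.**  Seat ym-line-sfw-p2-w5 g22 (EXTRA WIDTH seat w5, cell ym-idea-1).
-/

set_option autoImplicit false

noncomputable section

open MeasureTheory Matrix Finset
open scoped Kronecker
open Literature.Probability.LatticeModels (Site)
open Literature.MathematicalPhysics.QuantumLattice (ZdEdge)

namespace Summit.QuantumFields.YangMills.Theorems.AllWindowsColdBoxBoxHighLine

namespace PlaqObsL2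

open Hypercontractivity
open LaplaceSandwich (flatten flatten_apply volume_preserving_flatten)

variable (H : ℕ)

/-! ## Edge variables are legs -/

/-- A chart edge variable, colour `c`, is the leg of the indicator of its lattice edge: `(freeVec H a ed)_c = u_{ed} ⬝ a^c`. -/
theorem freeVec_apply_eq_leg (a : LandauFree H → E3) (ed : ZdEdge 4) (c : Fin 3) :
    freeVec H a ed c = (fun e : LandauFree H => if (e.1.1 : ZdEdge 4) = ed then (1 : ℝ) else 0) ⬝ᵥ fun e => a e c := by
  rw [EdgeChartGaussian.freeVec_apply_eq_sum]
  simp only [dotProduct, ite_mul, one_mul, zero_mul]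

/-- The squared norm of a chart edge variable is the colour sum of squares of its legs. -/
theorem norm_sq_freeVec_eq (a : LandauFree H → E3) (ed : ZdEdge 4) :
    ‖freeVec H a ed‖ ^ 2 =
      ∑ c : Fin 3, ((fun e : LandauFree H => if (e.1.1 : ZdEdge 4) = ed then (1 : ℝ) else 0) ⬝ᵥ fun e => a e c) ^ 2 := by
  rw [EuclideanSpace.norm_sq_eq]
  refine Finset.sum_congr rfl fun c _ => ?_
  rw [Real.norm_eq_abs, sq_abs, freeVec_apply_eq_leg]

/-- The kernel value of an indicator leg: `0 ≤ u_{ed}·hodgeQ⁻¹·u_{ed} ≤ 1036` (a diagonal entry of `hodgeQ⁻¹`, or `0` if `ed` is not a free box edge). -/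
theorem indicator_kernel_bounds (ed : ZdEdge 4) :
    0 ≤ (fun e : LandauFree H => if (e.1.1 : ZdEdge 4) = ed then (1 : ℝ) else 0) ⬝ᵥ
        ((hodgeQ H)⁻¹ *ᵥ fun e : LandauFree H => if (e.1.1 : ZdEdge 4) = ed then (1 : ℝ) else 0) ∧
      (fun e : LandauFree H => if (e.1.1 : ZdEdge 4) = ed then (1 : ℝ) else 0) ⬝ᵥ
        ((hodgeQ H)⁻¹ *ᵥ fun e : LandauFree H => if (e.1.1 : ZdEdge 4) = ed then (1 : ℝ) else 0) ≤ 1036 := by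
  classical
  by_cases hex : ∃ e₀ : LandauFree H, (e₀.1.1 : ZdEdge 4) = ed
  · obtain ⟨e₀, he₀⟩ := hex
    have hu : (fun e : LandauFree H => if (e.1.1 : ZdEdge 4) = ed then (1 : ℝ) else 0) = Pi.single e₀ 1 := by
      funext e
      by_cases h : e = e₀
      · subst h; simp [he₀]
      · have h' : (e.1.1 : ZdEdge 4) ≠ ed := fun h'' => h (EdgeChartGaussian.landauFree_ext (h''.trans he₀.symm))
        simp [h, h']
    rw [hu, single_one_dotProduct, Matrix.mulVec_single_one]
    exact ⟨(hodgeQ_posDef H).inv.posSemidef.diag_nonneg,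
      HodgePoincare.inv_diag_le_of_pointwise (hodgeQ H) (hodgeQ_posDef H) e₀ (by norm_num) fun w => sq_le_dotProduct_hodgeQ H e₀ w⟩
  · have hu : (fun e : LandauFree H => if (e.1.1 : ZdEdge 4) = ed then (1 : ℝ) else 0) = 0 := by
      funext e
      have h' : (e.1.1 : ZdEdge 4) ≠ ed := fun h'' => hex ⟨e, h''⟩
      simp [h']
    rw [hu]
    simp

/-! ## One-leg Gaussian sizes (any leg `u`) -/

/-- **`E₀[Σ_c (u⬝a^c)²] = (3/2)·β⁻¹·(u·hodgeQ⁻¹·u)`** for every `u`. -/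
theorem gaussAvg_colourSq {β : ℝ} (hβ : 0 < β) (u : LandauFree H → ℝ) :
    gaussAvg β H (fun a => ∑ c : Fin 3, (u ⬝ᵥ fun e => a e c) ^ 2) = 3 / 2 * β⁻¹ * (u ⬝ᵥ ((hodgeQ H)⁻¹ *ᵥ u)) := by
  have hZ := PlaqObsL4.integral_gaussWeight_pos H hβ
  unfold gaussAvg
  simp only [PlaqObsL4.gaussWeight_eq]
  rw [EdgeChartGaussian.integral_colourSumSq_mul_exp (hodgeQ H) (hodgeQ_posDef H) hβ,
    EdgeChartGaussian.integral_exp_neg_colourForm (hodgeQ H) (hodgeQ_posDef H) hβ]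
  have hZ' : 0 < Real.sqrt (Real.pi / β) ^ Fintype.card (LandauFree H × Fin 3) /
      Real.sqrt (hodgeQ H ⊗ₖ (1 : Matrix (Fin 3) (Fin 3) ℝ)).det := by
    rw [← EdgeChartGaussian.integral_exp_neg_colourForm (hodgeQ H) (hodgeQ_posDef H) hβ]; exact hZ
  rw [mul_div_cancel_left₀ _ hZ'.ne']
  field_simp

/-- **`E₀[(Σ_c (u⬝a^c)²)²] = (15/4)·β⁻²·(u·hodgeQ⁻¹·u)²`** for every `u`. -/
theorem gaussAvg_colourSq_sq {β : ℝ} (hβ : 0 < β) (u : LandauFree H → ℝ) :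
    gaussAvg β H (fun a => (∑ c : Fin 3, (u ⬝ᵥ fun e => a e c) ^ 2) ^ 2) = 15 / 4 * (β⁻¹) ^ 2 * (u ⬝ᵥ ((hodgeQ H)⁻¹ *ᵥ u)) ^ 2 := by
  have hcov := EdgeChartGaussian.cov_colourSumSq (hodgeQ H) (hodgeQ_posDef H) hβ u u
  have hmean := gaussAvg_colourSq H hβ u
  unfold gaussAvg at hmean ⊢
  simp only [PlaqObsL4.gaussWeight_eq] at hmean ⊢
  rw [hmean] at hcov
  have hsq : ∀ a : LandauFree H → E3, (∑ c : Fin 3, (u ⬝ᵥ fun e => a e c) ^ 2) ^ 2 =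
      (∑ c : Fin 3, (u ⬝ᵥ fun e => a e c) ^ 2) * (∑ c : Fin 3, (u ⬝ᵥ fun e => a e c) ^ 2) := fun a => pow_two _
  simp only [hsq]
  linear_combination hcov

/-- **One edge**: `E₀[‖freeVec H a ed‖⁴] ≤ (15/4)·1036²/β²`. -/
theorem gaussAvg_norm_freeVec_pow_four_le {β : ℝ} (hβ : 0 < β) (ed : ZdEdge 4) :
    gaussAvg β H (fun a => (‖freeVec H a ed‖ ^ 2) ^ 2) ≤ 15 / 4 * 1036 ^ 2 / β ^ 2 := by
  simp only [norm_sq_freeVec_eq]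
  rw [gaussAvg_colourSq_sq H hβ]
  obtain ⟨h0, h1⟩ := indicator_kernel_bounds H ed
  have hK : ((fun e : LandauFree H => if (e.1.1 : ZdEdge 4) = ed then (1 : ℝ) else 0) ⬝ᵥ
      ((hodgeQ H)⁻¹ *ᵥ fun e : LandauFree H => if (e.1.1 : ZdEdge 4) = ed then (1 : ℝ) else 0)) ^ 2 ≤ 1036 ^ 2 :=
    pow_le_pow_left₀ h0 h1 2
  have hβ2 : 0 < (β⁻¹) ^ 2 := by positivity
  calc 15 / 4 * (β⁻¹) ^ 2 * _ ≤ 15 / 4 * (β⁻¹) ^ 2 * 1036 ^ 2 := mul_le_mul_of_nonneg_left hK (by positivity)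
    _ = 15 / 4 * 1036 ^ 2 / β ^ 2 := by field_simp

/-! ## Integrability in the `a`-letters of observables polynomial in the flat variable, and the algebra of `gaussAvg` -/

/-- The Gaussian weight in the flat variable. -/
theorem gaussWeight_eq_flat (β : ℝ) (a : LandauFree H → E3) :
    gaussWeight β H a = Real.exp (-(β * (flatten (LandauFree H) a ⬝ᵥ ((hodgeQ H ⊗ₖ (1 : Matrix (Fin 3) (Fin 3) ℝ)) *ᵥ flatten (LandauFree H) a)))) := by
  rw [PlaqObsL4.gaussWeight_eq, EdgeChartGaussian.colourForm_eq_flat]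


/-- **Integrability transfer**: if `F a = G(♭a)` with `G` certified polynomial in the flat chart variable, then `F·gaussWeight` is integrable. -/
theorem integrable_polyFlat_mul_gaussWeight {β : ℝ} (hβ : 0 < β) {F : (LandauFree H → E3) → ℝ}
    {G : (LandauFree H × Fin 3 → ℝ) → ℝ} {d : ℕ}
    (hG : ∃ Q : MvPolynomial (LandauFree H × Fin 3) ℝ, Q.totalDegree ≤ d ∧ ∀ v, G v = MvPolynomial.eval v Q)
    (hFG : ∀ a, F a = G (flatten (LandauFree H) a)) :
    Integrable (fun a : LandauFree H → E3 => F a * gaussWeight β H a) := by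
  have hP : (hodgeQ H ⊗ₖ (1 : Matrix (Fin 3) (Fin 3) ℝ)).PosDef := GaussianChartWick.posDef_kronecker_one _ (hodgeQ_posDef H)
  have h := integrable_mul_exp_quadForm_of_polyDeg _ hP hβ hG
  rw [← (volume_preserving_flatten (LandauFree H)).integrable_comp_emb (MeasurableEquiv.measurableEmbedding _)] at h
  refine h.congr (Filter.Eventually.of_forall fun a => ?_)
  simp only [Function.comp_apply, hFG, gaussWeight_eq_flat]

/-- A leg `u ⬝ a^c` is polynomial of degree `≤ 1` in the flat variable. -/
theorem polyDeg_leg (u : LandauFree H → ℝ) (c : Fin 3) :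
    ∃ Q : MvPolynomial (LandauFree H × Fin 3) ℝ, Q.totalDegree ≤ 1 ∧
      ∀ v : LandauFree H × Fin 3 → ℝ, ((fun p : LandauFree H × Fin 3 => if p.2 = c then u p.1 else 0) ⬝ᵥ v) = MvPolynomial.eval v Q :=
  polyDeg_dotProduct _ le_rfl

/-- The colour sum of squares `Σ_c (u⬝a^c)²` is polynomial of degree `≤ 2` in the flat variable. -/
theorem polyDeg_colourSq (u : LandauFree H → ℝ) :
    ∃ Q : MvPolynomial (LandauFree H × Fin 3) ℝ, Q.totalDegree ≤ 2 ∧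
      ∀ v : LandauFree H × Fin 3 → ℝ,
        (∑ c : Fin 3, ((fun p : LandauFree H × Fin 3 => if p.2 = c then u p.1 else 0) ⬝ᵥ v) ^ 2) = MvPolynomial.eval v Q := by
  refine polyDeg_sum Finset.univ
    (F := fun c v => ((fun p : LandauFree H × Fin 3 => if p.2 = c then u p.1 else 0) ⬝ᵥ v) ^ 2) fun c _ => ?_
  exact polyDeg_mono (by norm_num) (polyDeg_pow (polyDeg_leg H u c) 2)

/-- The colour sum of squares in the `a`-letters is its flat version at `♭a`. -/
theorem colourSq_eq_flat (u : LandauFree H → ℝ) (a : LandauFree H → E3) :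
    (∑ c : Fin 3, (u ⬝ᵥ fun e => a e c) ^ 2) =
      ∑ c : Fin 3, ((fun p : LandauFree H × Fin 3 => if p.2 = c then u p.1 else 0) ⬝ᵥ flatten (LandauFree H) a) ^ 2 := by
  simp only [EdgeChartGaussian.leg_eq_flat]

/-- **Monotonicity of `gaussAvg`** against an integrable dominator: `0 ≤ f ≤ g`, `g·w` integrable ⇒ `E₀[f] ≤ E₀[g]`. -/
theorem gaussAvg_mono {β : ℝ} (hβ : 0 < β) {f g : (LandauFree H → E3) → ℝ} (hf : ∀ a, 0 ≤ f a) (hfg : ∀ a, f a ≤ g a)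
    (hg : Integrable (fun a => g a * gaussWeight β H a)) : gaussAvg β H f ≤ gaussAvg β H g := by
  have hZ := PlaqObsL4.integral_gaussWeight_pos H hβ
  unfold gaussAvg
  refine div_le_div_of_nonneg_right ?_ hZ.le
  refine integral_mono_of_nonneg (Filter.Eventually.of_forall fun a => ?_) hg (Filter.Eventually.of_forall fun a => ?_)
  · exact mul_nonneg (hf a) (Real.exp_pos _).le
  · exact mul_le_mul_of_nonneg_right (hfg a) (Real.exp_pos _).le

/-- `gaussAvg` is additive on integrable observables. -/
theorem gaussAvg_add {β : ℝ} (f g : (LandauFree H → E3) → ℝ) (hf : Integrable (fun a => f a * gaussWeight β H a))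
    (hg : Integrable (fun a => g a * gaussWeight β H a)) :
    gaussAvg β H (fun a => f a + g a) = gaussAvg β H f + gaussAvg β H g := by
  unfold gaussAvg
  rw [← add_div]
  congr 1
  rw [← integral_add hf hg]
  refine integral_congr_ae (Filter.Eventually.of_forall fun a => ?_)
  ring

/-- `gaussAvg` is homogeneous. -/
theorem gaussAvg_const_mul {β : ℝ} (r : ℝ) (f : (LandauFree H → E3) → ℝ) :
    gaussAvg β H (fun a => r * f a) = r * gaussAvg β H f := by
  unfold gaussAvg
  rw [← mul_div_assoc, ← integral_const_mul]
  congr 1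
  refine integral_congr_ae (Filter.Eventually.of_forall fun a => ?_)
  beta_reduce
  ring

/-- `gaussAvg` of a finite sum of integrable observables. -/
theorem gaussAvg_sum {β : ℝ} {κ : Type*} (s : Finset κ) (f : κ → (LandauFree H → E3) → ℝ)
    (hf : ∀ k ∈ s, Integrable (fun a => f k a * gaussWeight β H a)) :
    gaussAvg β H (fun a => ∑ k ∈ s, f k a) = ∑ k ∈ s, gaussAvg β H (f k) := by
  unfold gaussAvg
  rw [← Finset.sum_div]
  congr 1
  rw [← integral_finsetSum _ hf]
  refine integral_congr_ae (Filter.Eventually.of_forall fun a => ?_)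
  beta_reduce
  rw [Finset.sum_mul]

/-! ## The edge energy `S = Σ_{i<4} ‖v_i‖²` of a plaquette: second and fourth Gaussian moments -/

/-- `S` in the flat variable: `Σ_i ‖plaqVar H x μ ν a i‖² = Σ_i Σ_c (ℓ_{ic} ⬝ ♭a)²`. -/
theorem edgeSq_eq_flat (x : Site 4) (μ ν : Fin 4) (a : LandauFree H → E3) :
    ∑ i : Fin 4, ‖plaqVar H x μ ν a i‖ ^ 2 =
      ∑ i : Fin 4, ∑ c : Fin 3,
        ((fun p : LandauFree H × Fin 3 => if p.2 = c then
            (fun e : LandauFree H => if (e.1.1 : ZdEdge 4) = plaqEdge x μ ν i then (1 : ℝ) else 0) p.1 else 0) ⬝ᵥ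
          flatten (LandauFree H) a) ^ 2 := by
  refine Finset.sum_congr rfl fun i _ => ?_
  rw [plaqVar, norm_sq_freeVec_eq, colourSq_eq_flat]

/-- `S` is polynomial of degree `≤ 2` in the flat variable. -/
theorem polyDeg_edgeSq (x : Site 4) (μ ν : Fin 4) :
    ∃ Q : MvPolynomial (LandauFree H × Fin 3) ℝ, Q.totalDegree ≤ 2 ∧ ∀ v : LandauFree H × Fin 3 → ℝ,
      (∑ i : Fin 4, ∑ c : Fin 3,
        ((fun p : LandauFree H × Fin 3 => if p.2 = c then
            (fun e : LandauFree H => if (e.1.1 : ZdEdge 4) = plaqEdge x μ ν i then (1 : ℝ) else 0) p.1 else 0) ⬝ᵥ v) ^ 2) =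
        MvPolynomial.eval v Q :=
by
  refine polyDeg_sum Finset.univ (F := fun i v => ∑ c : Fin 3,
      ((fun p : LandauFree H × Fin 3 => if p.2 = c then
          (fun e : LandauFree H => if (e.1.1 : ZdEdge 4) = plaqEdge x μ ν i then (1 : ℝ) else 0) p.1 else 0) ⬝ᵥ v) ^ 2) ?_
  intro i _
  exact polyDeg_colourSq H (fun e : LandauFree H => if (e.1.1 : ZdEdge 4) = plaqEdge x μ ν i then (1 : ℝ) else 0)

/-- Powers of `S` against the Gaussian weight are integrable. -/
theorem integrable_edgeSq_pow_mul_gaussWeight {β : ℝ} (hβ : 0 < β) (x : Site 4) (μ ν : Fin 4) (k : ℕ) :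
    Integrable (fun a : LandauFree H → E3 => (∑ i : Fin 4, ‖plaqVar H x μ ν a i‖ ^ 2) ^ k * gaussWeight β H a) :=
  integrable_polyFlat_mul_gaussWeight H hβ (polyDeg_pow (polyDeg_edgeSq H x μ ν) k) fun a => by rw [edgeSq_eq_flat]

/-- ★ **`E₀[S²] ≤ 60·1036²/β²`** (`S² ≤ 4Σ_i‖v_i‖⁴` and the one-edge fourth moments). -/
theorem gaussAvg_edgeSq_sq_le {β : ℝ} (hβ : 0 < β) (x : Site 4) (μ ν : Fin 4) :
    gaussAvg β H (fun a => (∑ i : Fin 4, ‖plaqVar H x μ ν a i‖ ^ 2) ^ 2) ≤ 60 * 1036 ^ 2 / β ^ 2 := by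
  -- pointwise Cauchy–Schwarz `(Σ_{i<4} y_i)² ≤ 4 Σ y_i²`
  have hpt : ∀ a : LandauFree H → E3, (∑ i : Fin 4, ‖plaqVar H x μ ν a i‖ ^ 2) ^ 2 ≤
      4 * ∑ i : Fin 4, (‖plaqVar H x μ ν a i‖ ^ 2) ^ 2 := by
    intro a
    have h := sq_sum_le_card_mul_sum_sq (s := (Finset.univ : Finset (Fin 4))) (f := fun i => ‖plaqVar H x μ ν a i‖ ^ 2)
    simpa using h
  have hint : ∀ i ∈ (Finset.univ : Finset (Fin 4)),
      Integrable (fun a : LandauFree H → E3 => (‖plaqVar H x μ ν a i‖ ^ 2) ^ 2 * gaussWeight β H a) := by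
    intro i _
    refine integrable_polyFlat_mul_gaussWeight H hβ (polyDeg_pow (polyDeg_colourSq H
      (fun e : LandauFree H => if (e.1.1 : ZdEdge 4) = plaqEdge x μ ν i then (1 : ℝ) else 0)) 2) fun a => ?_
    rw [plaqVar, norm_sq_freeVec_eq, colourSq_eq_flat]
  have hsum : Integrable (fun a : LandauFree H → E3 => (4 * ∑ i : Fin 4, (‖plaqVar H x μ ν a i‖ ^ 2) ^ 2) * gaussWeight β H a) := by
    have h := (integrable_finsetSum _ hint).const_mul 4
    refine h.congr (Filter.Eventually.of_forall fun a => ?_)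
    simp only [Finset.sum_mul, Finset.mul_sum, mul_assoc]
  calc gaussAvg β H (fun a => (∑ i : Fin 4, ‖plaqVar H x μ ν a i‖ ^ 2) ^ 2)
      ≤ gaussAvg β H (fun a => 4 * ∑ i : Fin 4, (‖plaqVar H x μ ν a i‖ ^ 2) ^ 2) :=
        gaussAvg_mono H hβ (fun a => sq_nonneg _) hpt hsum
    _ = 4 * ∑ i : Fin 4, gaussAvg β H (fun a => (‖plaqVar H x μ ν a i‖ ^ 2) ^ 2) := by
        rw [gaussAvg_const_mul, gaussAvg_sum H _ _ hint]
    _ ≤ 4 * ∑ _i : Fin 4, 15 / 4 * 1036 ^ 2 / β ^ 2 := by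
        refine mul_le_mul_of_nonneg_left (Finset.sum_le_sum fun i _ => ?_) (by norm_num)
        exact gaussAvg_norm_freeVec_pow_four_le H hβ (plaqEdge x μ ν i)
    _ = 60 * 1036 ^ 2 / β ^ 2 := by simp; ring

/-- ★ **`E₀[S⁴] ≤ 81·E₀[S²]²`** — Gaussian hypercontractivity for the degree-2 polynomial `S` of the flat chart variable. -/
theorem gaussAvg_edgeSq_pow_four_le_sq {β : ℝ} (hβ : 0 < β) (x : Site 4) (μ ν : Fin 4) :
    gaussAvg β H (fun a => (∑ i : Fin 4, ‖plaqVar H x μ ν a i‖ ^ 2) ^ 4) ≤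
      81 * gaussAvg β H (fun a => (∑ i : Fin 4, ‖plaqVar H x μ ν a i‖ ^ 2) ^ 2) ^ 2 := by
  have hZ := PlaqObsL4.integral_gaussWeight_pos H hβ
  set P : Matrix (LandauFree H × Fin 3) (LandauFree H × Fin 3) ℝ := hodgeQ H ⊗ₖ (1 : Matrix (Fin 3) (Fin 3) ℝ) with hP
  have hPd : P.PosDef := GaussianChartWick.posDef_kronecker_one _ (hodgeQ_posDef H)
  have hG := polyDeg_edgeSq H x μ ν
  have hH := integral_pow_four_mul_integral_exp_le_of_polyDeg P hPd hβ hG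
  -- transfer the three integrals to the flat variable
  have h4 : ∫ a : LandauFree H → E3, (∑ i : Fin 4, ‖plaqVar H x μ ν a i‖ ^ 2) ^ 4 * gaussWeight β H a =
      ∫ v : LandauFree H × Fin 3 → ℝ, (∑ i : Fin 4, ∑ c : Fin 3,
        ((fun p : LandauFree H × Fin 3 => if p.2 = c then
            (fun e : LandauFree H => if (e.1.1 : ZdEdge 4) = plaqEdge x μ ν i then (1 : ℝ) else 0) p.1 else 0) ⬝ᵥ v) ^ 2) ^ 4 *
          Real.exp (-(β * (v ⬝ᵥ (P *ᵥ v)))) := by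
    rw [← EdgeChartGaussian.integral_eq_flat]
    refine integral_congr_ae (Filter.Eventually.of_forall fun a => ?_)
    simp only [edgeSq_eq_flat, gaussWeight_eq_flat]
    rfl
  have h2 : ∫ a : LandauFree H → E3, (∑ i : Fin 4, ‖plaqVar H x μ ν a i‖ ^ 2) ^ 2 * gaussWeight β H a =
      ∫ v : LandauFree H × Fin 3 → ℝ, (∑ i : Fin 4, ∑ c : Fin 3,
        ((fun p : LandauFree H × Fin 3 => if p.2 = c then
            (fun e : LandauFree H => if (e.1.1 : ZdEdge 4) = plaqEdge x μ ν i then (1 : ℝ) else 0) p.1 else 0) ⬝ᵥ v) ^ 2) ^ 2 *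
          Real.exp (-(β * (v ⬝ᵥ (P *ᵥ v)))) := by
    rw [← EdgeChartGaussian.integral_eq_flat]
    refine integral_congr_ae (Filter.Eventually.of_forall fun a => ?_)
    simp only [edgeSq_eq_flat, gaussWeight_eq_flat]
    rfl
  have h0 : ∫ a : LandauFree H → E3, gaussWeight β H a =
      ∫ v : LandauFree H × Fin 3 → ℝ, Real.exp (-(β * (v ⬝ᵥ (P *ᵥ v)))) := by
    rw [← EdgeChartGaussian.integral_eq_flat]
    refine integral_congr_ae (Filter.Eventually.of_forall fun a => ?_)
    simp only [gaussWeight_eq_flat]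
    rfl
  unfold gaussAvg
  rw [h4, h2, h0]
  rw [h0] at hZ
  set A := ∫ v : LandauFree H × Fin 3 → ℝ, (∑ i : Fin 4, ∑ c : Fin 3,
        ((fun p : LandauFree H × Fin 3 => if p.2 = c then
            (fun e : LandauFree H => if (e.1.1 : ZdEdge 4) = plaqEdge x μ ν i then (1 : ℝ) else 0) p.1 else 0) ⬝ᵥ v) ^ 2) ^ 4 *
          Real.exp (-(β * (v ⬝ᵥ (P *ᵥ v)))) with hA
  set B := ∫ v : LandauFree H × Fin 3 → ℝ, (∑ i : Fin 4, ∑ c : Fin 3,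
        ((fun p : LandauFree H × Fin 3 => if p.2 = c then
            (fun e : LandauFree H => if (e.1.1 : ZdEdge 4) = plaqEdge x μ ν i then (1 : ℝ) else 0) p.1 else 0) ⬝ᵥ v) ^ 2) ^ 2 *
          Real.exp (-(β * (v ⬝ᵥ (P *ᵥ v)))) with hB
  set Z := ∫ v : LandauFree H × Fin 3 → ℝ, Real.exp (-(β * (v ⬝ᵥ (P *ᵥ v)))) with hZdef
  have key : A * Z ≤ 81 * B ^ 2 := by
    have h := hH
    norm_num at h
    exact h
  calc A / Z = A * Z / Z ^ 2 := by field_simp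
    _ ≤ 81 * B ^ 2 / Z ^ 2 := div_le_div_of_nonneg_right key (sq_nonneg _)
    _ = 81 * (B / Z) ^ 2 := by rw [div_pow]; ring

/-- ★ **`E₀[S⁴] ≤ 81·60²·1036⁴/β⁴`**. -/
theorem gaussAvg_edgeSq_pow_four_le {β : ℝ} (hβ : 0 < β) (x : Site 4) (μ ν : Fin 4) :
    gaussAvg β H (fun a => (∑ i : Fin 4, ‖plaqVar H x μ ν a i‖ ^ 2) ^ 4) ≤ 81 * (60 * 1036 ^ 2) ^ 2 / β ^ 4 := by
  have h2 := gaussAvg_edgeSq_sq_le H hβ x μ ν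
  have h2' : 0 ≤ gaussAvg β H (fun a => (∑ i : Fin 4, ‖plaqVar H x μ ν a i‖ ^ 2) ^ 2) := by
    unfold gaussAvg
    exact div_nonneg (integral_nonneg fun a => mul_nonneg (sq_nonneg _) (Real.exp_pos _).le)
      (PlaqObsL4.integral_gaussWeight_pos H hβ).le
  calc gaussAvg β H (fun a => (∑ i : Fin 4, ‖plaqVar H x μ ν a i‖ ^ 2) ^ 4)
      ≤ 81 * gaussAvg β H (fun a => (∑ i : Fin 4, ‖plaqVar H x μ ν a i‖ ^ 2) ^ 2) ^ 2 := gaussAvg_edgeSq_pow_four_le_sq H hβ x μ ν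
    _ ≤ 81 * (60 * 1036 ^ 2 / β ^ 2) ^ 2 := mul_le_mul_of_nonneg_left (pow_le_pow_left₀ h2' h2 2) (by norm_num)
    _ = 81 * (60 * 1036 ^ 2) ^ 2 / β ^ 4 := by field_simp

end PlaqObsL2

end Summit.QuantumFields.YangMills.Theorems.AllWindowsColdBoxBoxHighLine

end
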